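import Literature.AlgebraicGeometry.Motives.GeneratingSectionsFrameIndependence
import Literature.AlgebraicGeometry.Motives.CartierDivisorLineBundleSectionsOn
import Literature.AlgebraicGeometry.Motives.AbelianVarietyDegree
import Literature.AlgebraicGeometry.Morphisms.ProjectiveSpaceOverBasePoints
import Literature.AlgebraicGeometry.Morphisms.ProjectiveOfFibreEmbedding
import Literature.AlgebraicGeometry.Modules.LineBundleOfCocycleClass
import HarnessLib

/-!
# A very ample divisor embeds by every spanning family of `Γ(𝒪(D))`

Let `Z → Spec k` be an integral `k`-scheme (`k` a field) with a closed immersion `Ψ : Z ↪ ℙ^N_k` over `k`, let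
`a₀` be a homogeneous coordinate not vanishing at the generic point, `H_Ψ = (Ψ^*x_{a₀} = 0)` the hyperplane-section
Cartier divisor (★ `GeneratingSections.divisor`), and let `D` be a Cartier divisor with `D ∼ H_Ψ` ("`D` is very ample,
realised by `Ψ`"). We prove, in the generating-sections dialect of the tree (★ `GeneratingSections.ofCocycleSections`,
★ `CocycleSections.ofFrameSystem`, any frame system `F` of rank `1` of the line bundle `𝒪_Z(D)` =
★ `Modules.lineBundle D.toUnitCocycle`):

* `CartierDivisor.ofCocycleSections_eq_ofHom` — transporting the sections `Ψ^*x_a / Ψ^*x_{a₀}` of `𝒪(H_Ψ)` along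
  `D ∼ H_Ψ` gives global sections `t_0, …, t_N` of `𝒪_Z(D)` whose generating-sections datum (in the canonical frame)
  **is** the datum ★ `GeneratingSections.ofHom Ψ` of `Ψ`; hence
  (`exists_sections_isClosedImmersion_toProj_of_linEquiv_hyperplaneDivisor`, HEAD 1) in ANY rank-one frame system `F` the `t_a` generate and their morphism `Z → ℙ^N_k` is `Ψ`, a closed immersion
  (Hartshorne II Thm. 7.1: the morphism of `(𝓛, s_0, …, s_N)` with `𝓛 ≅ Ψ^*𝒪(1)`, `s_a = Ψ^*x_a` is `Ψ`; frame
  independence is ★ `GeneratingSections.ofCocycleSections_ofFrameSystem_eq`).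
* `CartierDivisor.iSup_basicOpen_coeff_eq_top_of_span_of_linEquiv_hyperplaneDivisor` (HEAD 3) — for `Z` any such scheme,
  every finite family `s` of global sections of `𝒪_Z(D)` which SPANS `Γ(Z, 𝒪_Z(D))` over `Γ(Spec k, 𝒪) = k` is
  base-point free; and (`isClosedImmersion_toProj_of_span_of_linEquiv_hyperplaneDivisor`, HEAD 2; `∃ hcov`-form
  `exists_isClosedImmersion_toProj_of_span_of_linEquiv_hyperplaneDivisor`, HEAD 4) for `Z` PROPER over `k` its morphism
  `Z → ℙ^m_k` is a closed immersion — the complete linear system `|D|` (and every spanning sub-system) embeds.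
  Proof: each `t_a` is a `k`-combination of the `s_j` (Hartshorne II Prop. 7.2 in the form ★
  `GeneratingSections.isClosedImmersion_toProj_of_linear` / ★ `iSup_basicOpen_inr_eq_top_of_linear` on the joint
  datum `(t, s)`).

§1 computes the coefficients of a global section in the canonical frame system ★ `UnitCocycle.lineBundleFrameSystem`
of `𝒪_Z(D)` as rational functions (GW (11.9): sections of `𝒪(D)` are rational functions `φ` with `f_i φ` regular).

References: [Hartshorne1977] R. Hartshorne, Algebraic Geometry, GTM 52, II §7, Thm. 7.1 and Prop. 7.2;
[GortzWedhorn2020] U. Görtz, T. Wedhorn, Algebraic Geometry I (2nd ed.), Section (11.9) (p. 301).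
-/

noncomputable section

universe u

open CategoryTheory AlgebraicGeometry TopologicalSpace Opposite
open Literature.AlgebraicGeometry.Modules Literature.AlgebraicGeometry.Motives.RatFn
open Literature.AlgebraicGeometry.Motives.GeneratingSections

namespace Literature.AlgebraicGeometry.Motives

namespace CartierDivisor

/-! ### §1 Coefficients of sections of `𝒪_Z(D)` in the canonical frame -/

section CanonicalFrame

variable {Z : Scheme.{u}} [IsIntegral Z] (D : CartierDivisor Z) {ι : Type}
  (t : ι → Γ(Modules.lineBundle D.toUnitCocycle, ⊤))

/-- In the canonical frame system of `𝒪_Z(D)` (★ `UnitCocycle.lineBundleFrameSystem`: on the chart `U_{i(x)}` of `x` the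
generator `t_x` has rational function `φ(t_x) = 1/f_{i(x)}`), the coefficient of a global section `t_i` at `x`, read as a
rational function, is `f_{i(x)} · φ(t_i)`. [cite: GortzWedhorn2020, Section (11.9) (p. 301)] -/
theorem ofSection_coeffAt_lineBundleFrameSystem (i : ι) (x : Z) :
    ofSection (genericPoint_mem_of_mem (D.toUnitCocycle.mem x))
        (coeffAt D.toUnitCocycle.lineBundleFrameSystem D.toUnitCocycle.lineBundleFrameSystem_rank t i x) =
      D.f (D.chartIdx x) * D.lineBundleRatFn (W := ⊤) trivial (t i) := by
  classical
  have hξx : genericPoint Z ∈ D.toUnitCocycle.U x := genericPoint_mem_of_mem (D.toUnitCocycle.mem x)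
  -- `t_i|_{U_x} = c · b_x`, `b_x = t_x` the local generator
  have h := map_top_eq_coeffAt_smul D.toUnitCocycle.lineBundleFrameSystem
    D.toUnitCocycle.lineBundleFrameSystem_rank t i x
  have hb : (Modules.lineBundle D.toUnitCocycle).presheaf.map
      (𝟙 (D.toUnitCocycle.lineBundleFrameSystem.U x)).op
      (basisSection (D.toUnitCocycle.lineBundleFrameSystem.frame x)
        (D.toUnitCocycle.lineBundleFrameSystem.idx D.toUnitCocycle.lineBundleFrameSystem_rank x)) =
      D.toUnitCocycle.lineBundleGen x (D.toUnitCocycle.U x) le_rfl := by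
    have : D.toUnitCocycle.lineBundleFrameSystem.idx D.toUnitCocycle.lineBundleFrameSystem_rank x = PUnit.unit :=
      rfl
    rw [this]
    change (Modules.lineBundle D.toUnitCocycle).presheaf.map (𝟙 _).op
      (basisSection (D.toUnitCocycle.lineBundleFrame x) PUnit.unit) = _
    rw [D.toUnitCocycle.basisSection_lineBundleFrame x, op_id, CategoryTheory.Functor.map_id]
    rfl
  rw [hb] at h
  -- read the rational functions: `φ(t_i) = ofSection(c) · φ(t_x)` and `φ(t_x) = 1 / f_{i(x)}`
  have h1 : D.lineBundleRatFn (W := ⊤) trivial (t i) =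
      ofSection hξx (coeffAt D.toUnitCocycle.lineBundleFrameSystem D.toUnitCocycle.lineBundleFrameSystem_rank t i x) *
        D.lineBundleRatFn hξx (D.toUnitCocycle.lineBundleGen x (D.toUnitCocycle.U x) le_rfl) := by
    rw [← D.lineBundleRatFn_map (homOfLE (le_top : D.toUnitCocycle.U x ≤ ⊤)) hξx (t i), ← D.lineBundleRatFn_smul]
    exact congrArg _ h
  have h2 : D.lineBundleRatFn hξx (D.toUnitCocycle.lineBundleGen x (D.toUnitCocycle.U x) le_rfl) =
      (D.f (D.chartIdx x))⁻¹ := by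
    rw [D.lineBundleRatFn_eq hξx _ x, UnitCocycle.comp_lineBundleGen, D.ofSection_toUnitCocycle_g, div_self (D.f_ne_zero _),
      one_div]
  rw [h2] at h1
  rw [h1, mul_left_comm, mul_inv_cancel₀ (D.f_ne_zero _), mul_one]

end CanonicalFrame

/-! ### §2 The sections `Ψ^*x_a` of `𝒪_Z(D)` for `D ∼ H_Ψ` and their generating-sections datum -/

section VeryAmple

variable {k : Type u} [Field k] (Z : SchemeOver k) [IsIntegral Z.left] (D : CartierDivisor Z.left)
  {N : ℕ} (Ψ : Z ⟶ projectiveSpace N k) (a₀ : Fin (N + 1))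
  (ha₀ : genericPoint Z.left ∈ (GeneratingSections.ofHom Ψ.left).U a₀)

/-- **The sections `Ψ^*x_a` of `𝒪_Z(D)` for `D ∼ H_Ψ`.** If `D ∼ H_Ψ` (witnessed by `g ≠ 0` with `H_Ψ.f_i · g / D.f_j`
units on overlaps), the rational functions `(x_a/x_{a₀}) ∘ Ψ · g⁻¹` are sections of `D`, i.e. global sections
`t_0, …, t_N` of `𝒪_Z(D)` (★ `lineBundleSectionOfRatFn`). [cite: GortzWedhorn2020, Section (11.9) (p. 301)]
[cite: Hartshorne1977, II Thm. 7.1] -/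
theorem exists_sections_lineBundleRatFn_eq (hlin : D.LinEquiv ((GeneratingSections.ofHom Ψ.left).divisor a₀ ha₀)) :
    ∃ (g : Z.left.functionField) (_ : g ≠ 0)
      (_ : ∀ i j (x : Z.left), x ∈ ((GeneratingSections.ofHom Ψ.left).divisor a₀ ha₀).U i → x ∈ D.U j →
        IsUnitAt x (((GeneratingSections.ofHom Ψ.left).divisor a₀ ha₀).f i * g / D.f j))
      (t : Fin (N + 1) → Γ(Modules.lineBundle D.toUnitCocycle, ⊤)),
      ∀ a, D.lineBundleRatFn (W := ⊤) trivial (t a) = (GeneratingSections.ofHom Ψ.left).ratioFn a₀ a ha₀ * g⁻¹ := by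
  obtain ⟨g, hg, hunit⟩ := (linEquiv_iff _ _).1 hlin.symm
  have hsec : ∀ a, D.IsSection ((GeneratingSections.ofHom Ψ.left).ratioFn a₀ a ha₀ * g⁻¹) := fun a =>
    IsSection.of_linEquiv hg hunit ((GeneratingSections.ofHom Ψ.left).isSection_divisor_ratioFn a₀ ha₀ a)
  refine ⟨g, hg, hunit, fun a => D.lineBundleSectionOfRatFn (W := ⊤) trivial _ ((hsec a).isSectionOn _), fun a => ?_⟩
  exact D.lineBundleRatFn_lineBundleSectionOfRatFn (W := ⊤) trivial _ _

/-- The non-vanishing loci `Z_{t_a}` of the sections `t_a = Ψ^*x_a` of `𝒪_Z(D)` (canonical frame) are the preimages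
`Ψ⁻¹ D₊(x_a)` (★ `GeneratingSections.preU`): the local equations `f_{i(p)} φ(t_a)` and `H_Ψ.f_j · (x_a/x_{a₀}) ∘ Ψ`
differ by the unit `H_Ψ.f_j g / D.f_{i(p)}` at `p`. [cite: Hartshorne1977, II Thm. 7.1] [cite: GortzWedhorn2020, Section (11.9) (p. 301)] -/
theorem iSup_basicOpen_coeffAt_eq_preU {g : Z.left.functionField} (hg : g ≠ 0)
    (hunit : ∀ i j (x : Z.left), x ∈ ((GeneratingSections.ofHom Ψ.left).divisor a₀ ha₀).U i → x ∈ D.U j →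
      IsUnitAt x (((GeneratingSections.ofHom Ψ.left).divisor a₀ ha₀).f i * g / D.f j))
    (t : Fin (N + 1) → Γ(Modules.lineBundle D.toUnitCocycle, ⊤))
    (ht : ∀ a, D.lineBundleRatFn (W := ⊤) trivial (t a) = (GeneratingSections.ofHom Ψ.left).ratioFn a₀ a ha₀ * g⁻¹)
    (a : Fin (N + 1)) :
    ⨆ x, Z.left.basicOpen
        (coeffAt D.toUnitCocycle.lineBundleFrameSystem D.toUnitCocycle.lineBundleFrameSystem_rank t a x) =
      GeneratingSections.preU Ψ.left a := by
  set H := (GeneratingSections.ofHom Ψ.left).divisor a₀ ha₀ with hH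
  ext p
  change p ∈ (⨆ x, Z.left.basicOpen
      (coeffAt D.toUnitCocycle.lineBundleFrameSystem D.toUnitCocycle.lineBundleFrameSystem_rank t a x)) ↔
    p ∈ GeneratingSections.preU Ψ.left a
  rw [mem_iSup_basicOpen_coeffAt_iff]
  refine (isUnitAt_ofSection_iff (D.toUnitCocycle.mem p) _).symm.trans ?_
  rw [D.ofSection_coeffAt_lineBundleFrameSystem t a p, ht a]
  -- `p ∈ Ψ⁻¹D₊(x_a) ⟺ p ∈ X_{s_a}` for the section `s_a` of `𝒪(H_Ψ)`
  have hnv := (GeneratingSections.ofHom Ψ.left).nonvanishing_divisor_ratioFn a₀ ha₀ a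
  obtain ⟨j, hj⟩ := H.covers p
  have hp : p ∈ GeneratingSections.preU Ψ.left a ↔
      IsUnitAt p (H.f j * (GeneratingSections.ofHom Ψ.left).ratioFn a₀ a ha₀) := by
    rw [← mem_nonvanishing_iff hj, hnv]; rfl
  rw [hp]
  -- the two local equations differ by the unit `H.f j · g / D.f (i p)`
  have hu : IsUnitAt p (H.f j * g / D.f (D.chartIdx p)) := hunit j _ p hj (D.mem_U_chartIdx p)
  have hD0 : D.f (D.chartIdx p) ≠ 0 := D.f_ne_zero _
  have hH0 : H.f j ≠ 0 := H.f_ne_zero _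
  constructor
  · intro h1
    have := (hu.mul h1)
    convert this using 1
    field_simp
  · intro h1
    have := (hu.inv.mul h1)
    convert this using 1
    field_simp


/-- **Core identification.** The generating-sections datum of the sections `t_a = Ψ^*x_a` of `𝒪_Z(D)` (`D ∼ H_Ψ`) in the
canonical frame system IS the datum ★ `GeneratingSections.ofHom Ψ` of the morphism `Ψ : Z → ℙ^N_k` (same opens
`Ψ⁻¹D₊(x_a)`, same ratios `x_a/x_b ∘ Ψ`; ★ `GeneratingSections.eq_of_U_eq` + ★ `ofCocycleSections_ratio_unique`).
This is the uniqueness half of Hartshorne II Thm. 7.1 for `(𝒪_Z(D) ≅ Ψ^*𝒪(1), Ψ^*x_a)`.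
[cite: Hartshorne1977, II Thm. 7.1] -/
theorem ofCocycleSections_eq_ofHom {g : Z.left.functionField} (hg : g ≠ 0)
    (hunit : ∀ i j (x : Z.left), x ∈ ((GeneratingSections.ofHom Ψ.left).divisor a₀ ha₀).U i → x ∈ D.U j →
      IsUnitAt x (((GeneratingSections.ofHom Ψ.left).divisor a₀ ha₀).f i * g / D.f j))
    (t : Fin (N + 1) → Γ(Modules.lineBundle D.toUnitCocycle, ⊤))
    (ht : ∀ a, D.lineBundleRatFn (W := ⊤) trivial (t a) = (GeneratingSections.ofHom Ψ.left).ratioFn a₀ a ha₀ * g⁻¹)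
    (hcov : ⨆ i, ⨆ x, Z.left.basicOpen ((CocycleSections.ofFrameSystem D.toUnitCocycle.lineBundleFrameSystem
      D.toUnitCocycle.lineBundleFrameSystem_rank t).coeff i x) = ⊤) :
    ofCocycleSections D.toUnitCocycle.lineBundleFrameSystem.U
        (CocycleSections.ofFrameSystem D.toUnitCocycle.lineBundleFrameSystem
          D.toUnitCocycle.lineBundleFrameSystem_rank t) hcov =
      GeneratingSections.ofHom Ψ.left := by
  have hU : ∀ a, (ofCocycleSections D.toUnitCocycle.lineBundleFrameSystem.U
      (CocycleSections.ofFrameSystem D.toUnitCocycle.lineBundleFrameSystem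
        D.toUnitCocycle.lineBundleFrameSystem_rank t) hcov).U a = (GeneratingSections.ofHom Ψ.left).U a :=
    fun a => D.iSup_basicOpen_coeffAt_eq_preU Z Ψ a₀ ha₀ hg hunit t ht a
  refine eq_of_U_eq hU fun a b => ?_
  symm
  refine ofCocycleSections_ratio_unique _ _ hcov a b _ fun x => ?_
  apply RatFn.section_ext
  intro hB
  have hξa : genericPoint Z.left ∈ (GeneratingSections.ofHom Ψ.left).U a :=
    (hU a).le (basicOpen_le_ofCocycleSections_U _ _ hcov a x hB)
  rw [ofSection_mul', ofSection_map, ofSection_map, ofSection_map, ofSection_map]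
  change (GeneratingSections.ofHom Ψ.left).ratioFn a b hξa *
      ofSection (genericPoint_mem_of_mem (D.toUnitCocycle.mem x))
        (coeffAt D.toUnitCocycle.lineBundleFrameSystem D.toUnitCocycle.lineBundleFrameSystem_rank t a x) =
    ofSection (genericPoint_mem_of_mem (D.toUnitCocycle.mem x))
      (coeffAt D.toUnitCocycle.lineBundleFrameSystem D.toUnitCocycle.lineBundleFrameSystem_rank t b x)
  rw [D.ofSection_coeffAt_lineBundleFrameSystem t a x, D.ofSection_coeffAt_lineBundleFrameSystem t b x, ht a, ht b,
    ← (GeneratingSections.ofHom Ψ.left).ratioFn_mul_ratioFn a₀ a b ha₀ hξa]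
  ring

/-- **HEAD 1 — a very ample divisor is realised by sections of `𝒪_Z(D)`, in any frame.** For `Ψ : Z ↪ ℙ^N_k` a closed
immersion over `k` and `D ∼ H_Ψ`, there are global sections `t_0, …, t_N` of `𝒪_Z(D)` which generate it (in the given
rank-one frame system `F`) and whose morphism `Z → ℙ^N_k` (★ `GeneratingSections.toProj`) is a closed immersion — indeed
it is `Ψ` (`ofCocycleSections_eq_ofHom`, frame independence ★ `GeneratingSections.ofCocycleSections_ofFrameSystem_eq`,
★ `GeneratingSections.toProj_ofHom`). [cite: Hartshorne1977, II Thm. 7.1] -/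
theorem exists_sections_isClosedImmersion_toProj_of_linEquiv_hyperplaneDivisor [IsClosedImmersion Ψ.left]
    (hlin : D.LinEquiv ((GeneratingSections.ofHom Ψ.left).divisor a₀ ha₀))
    (F : FrameSystem (Modules.lineBundle D.toUnitCocycle)) (h1 : ∀ x, F.rank x = 1) :
    ∃ (t : Fin (N + 1) → Γ(Modules.lineBundle D.toUnitCocycle, ⊤))
      (hcov : ⨆ i, ⨆ x, Z.left.basicOpen ((CocycleSections.ofFrameSystem F h1 t).coeff i x) = ⊤),
      IsClosedImmersion ((GeneratingSections.ofCocycleSections F.U (CocycleSections.ofFrameSystem F h1 t) hcov).toProj Z.hom) := by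
  obtain ⟨g, hg, hunit, t, ht⟩ := D.exists_sections_lineBundleRatFn_eq Z Ψ a₀ ha₀ hlin
  set Fc := D.toUnitCocycle.lineBundleFrameSystem with hFc
  have h1c : ∀ x, Fc.rank x = 1 := D.toUnitCocycle.lineBundleFrameSystem_rank
  -- generation in the canonical frame: the `X_{t_a}` are the `Ψ⁻¹D₊(x_a)`, which cover
  have hcovc : ⨆ i, ⨆ x, Z.left.basicOpen ((CocycleSections.ofFrameSystem Fc h1c t).coeff i x) = ⊤ := by
    have : ∀ a, ⨆ x, Z.left.basicOpen ((CocycleSections.ofFrameSystem Fc h1c t).coeff a x) = GeneratingSections.preU Ψ.left a :=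
      fun a => D.iSup_basicOpen_coeffAt_eq_preU Z Ψ a₀ ha₀ hg hunit t ht a
    simp_rw [this]
    exact GeneratingSections.iSup_preU Ψ.left
  -- generation in the frame `F` (the loci `X_{t_a}` do not depend on the frame)
  have hWF : ⨆ x, F.U x = ⊤ := eq_top_iff.mpr fun x _ => Opens.mem_iSup.mpr ⟨x, F.mem x⟩
  have hcov : ⨆ i, ⨆ x, Z.left.basicOpen ((CocycleSections.ofFrameSystem F h1 t).coeff i x) = ⊤ := by
    refine top_le_iff.mp (hcovc.ge.trans (iSup_mono fun a => ?_))
    exact iSup_basicOpen_coeff_le_of_rescale (CocycleSections.ofFrameSystem Fc h1c t) (CocycleSections.ofFrameSystem F h1 t)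
      hWF _ (fun x y => isUnit_coord_basisSection Fc F h1c h1 x y)
      (fun i x y => map_coeffAt_eq_coord_mul_map_coeffAt Fc F h1c h1 t i x y) a
  refine ⟨t, hcov, ?_⟩
  rw [← ofCocycleSections_ofFrameSystem_eq Fc F h1c h1 t hcovc hcov,
    D.ofCocycleSections_eq_ofHom Z Ψ a₀ ha₀ hg hunit t ht hcovc,
    GeneratingSections.toProj_ofHom Z.hom Ψ.left (Over.w Ψ)]
  exact ‹IsClosedImmersion Ψ.left›

/-- Membership in the span of a finite family, as an explicit combination. [folklore] -/
private theorem exists_fun_of_mem_span {R M : Type*} [Semiring R] [AddCommMonoid M] [Module R M] {α : Type*}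
    [Fintype α] {v : α → M} {x : M} (hx : x ∈ Submodule.span R (Set.range v)) : ∃ c : α → R, ∑ i, c i • v i = x := by
  obtain ⟨c, hc⟩ := Finsupp.mem_span_range_iff_exists_finsupp.mp hx
  exact ⟨c, by rw [← hc, Finsupp.sum_fintype c (fun i a ↦ a • v i) (fun i ↦ zero_smul _ _)]⟩

/-- The joint datum `(t, s)`: the embedding family `t = Ψ^*x` of HEAD 1 is a `k`-linear combination `t_a = ∑_j c_{aj} s_j`
of any family `s` spanning `Γ(Z, 𝒪_Z(D))` over `Γ(Spec k, 𝒪)`, coefficient-wise in every frame (★ `coeffAt_sum_smul`).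
[cite: Hartshorne1977, II Prop. 7.2] -/
private theorem exists_joint_linear [IsClosedImmersion Ψ.left]
    (hlin : D.LinEquiv ((GeneratingSections.ofHom Ψ.left).divisor a₀ ha₀))
    (F : FrameSystem (Modules.lineBundle D.toUnitCocycle)) (h1 : ∀ x, F.rank x = 1) {m : ℕ}
    (s : Fin (m + 1) → Γ(Modules.lineBundle D.toUnitCocycle, ⊤))
    (hs : ∀ σ : Γ(Modules.lineBundle D.toUnitCocycle, ⊤),
      SecMod.mk (L := Modules.lineBundle D.toUnitCocycle) (ρ := Z.hom.appTop.hom) (U := ⊤) σ ∈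
        Submodule.span Γ(Spec (.of k), ⊤) (Set.range fun j ↦
          SecMod.mk (L := Modules.lineBundle D.toUnitCocycle) (ρ := Z.hom.appTop.hom) (U := ⊤) (s j))) :
    ∃ (t : Fin (N + 1) → Γ(Modules.lineBundle D.toUnitCocycle, ⊤)) (c : Fin (N + 1) → Fin (m + 1) → k)
      (hcovt : ⨆ i, ⨆ x, Z.left.basicOpen
        (((CocycleSections.ofFrameSystem F h1 (Sum.elim t s)).restrict Sum.inl).coeff i x) = ⊤),
      (∀ i x, (CocycleSections.ofFrameSystem F h1 (Sum.elim t s)).coeff (.inl i) x =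
        ∑ j, Z.left.presheaf.map (homOfLE (le_top : F.U x ≤ ⊤)).op (Segre.pull Z.hom (c i j)) *
          (CocycleSections.ofFrameSystem F h1 (Sum.elim t s)).coeff (.inr j) x) ∧
      IsClosedImmersion ((ofCocycleSections F.U
        ((CocycleSections.ofFrameSystem F h1 (Sum.elim t s)).restrict Sum.inl) hcovt).toProj Z.hom) := by
  classical
  obtain ⟨t, hcovt, Ht⟩ :=
    D.exists_sections_isClosedImmersion_toProj_of_linEquiv_hyperplaneDivisor Z Ψ a₀ ha₀ hlin F h1
  -- Step 1: each `t i` is a `Γ(Spec k, 𝒪)`-combination of the `s j`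
  have hc : ∀ i, ∃ c : Fin (m + 1) → Γ(Spec (.of k), ⊤),
      ∑ j, c j • SecMod.mk (L := Modules.lineBundle D.toUnitCocycle) (ρ := Z.hom.appTop.hom) (U := ⊤) (s j) =
        SecMod.mk (L := Modules.lineBundle D.toUnitCocycle) (ρ := Z.hom.appTop.hom) (U := ⊤) (t i) :=
    fun i ↦ exists_fun_of_mem_span (hs (t i))
  choose c hc using hc
  have hrel : ∀ i, t i = ∑ j, toSections Z.hom.appTop.hom ⊤ (c i j) • s j := fun i ↦ by
    have h := congrArg (SecMod.val (L := Modules.lineBundle D.toUnitCocycle) (ρ := Z.hom.appTop.hom)) (hc i)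
    rw [SecMod.val_mk] at h
    rw [← h]
    induction (Finset.univ : Finset (Fin (m + 1))) using Finset.induction_on with
    | empty => rfl
    | insert j T hj ih => rw [Finset.sum_insert hj, Finset.sum_insert hj, SecMod.val_add, ih]; rfl
  -- Step 2: the joint datum `(t, s)` and its linear relation over `k`
  let u : Fin (N + 1) ⊕ Fin (m + 1) → Γ(Modules.lineBundle D.toUnitCocycle, ⊤) := Sum.elim t s
  let S : CocycleSections (Fin (N + 1) ⊕ Fin (m + 1)) F.U := CocycleSections.ofFrameSystem F h1 u
  let cc : Fin (N + 1) → Fin (m + 1) → k := fun i j ↦ (Scheme.ΓSpecIso (.of k)).hom (c i j)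
  have hpull : ∀ i j, Segre.pull Z.hom (cc i j) = Z.hom.appTop (c i j) := fun i j ↦ by
    rw [Segre.pull_apply]
    change Z.hom.appTop (((Scheme.ΓSpecIso (.of k)).hom ≫ (Scheme.ΓSpecIso (.of k)).inv) (c i j)) = _
    rw [Iso.hom_inv_id]
    rfl
  have hlin' : ∀ i x, S.coeff (.inl i) x =
      ∑ j, Z.left.presheaf.map (homOfLE (le_top : F.U x ≤ ⊤)).op (Segre.pull Z.hom (cc i j)) *
        S.coeff (.inr j) x := by
    intro i x
    change coeffAt F h1 u (.inl i) x = ∑ j, _ * coeffAt F h1 u (.inr j) x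
    have hu : u (.inl i) = ∑ j ∈ Finset.univ, toSections Z.hom.appTop.hom ⊤ (c i j) • u (.inr j) := hrel i
    rw [coeffAt_sum_smul F h1 Finset.univ (fun j ↦ toSections Z.hom.appTop.hom ⊤ (c i j)) (fun j ↦ u (.inr j)) u
      (.inl i) hu x]
    refine Finset.sum_congr rfl fun j _ ↦ ?_
    congr 1
    rw [hpull, resO_toSections]
    rfl
  have hinl : S.restrict Sum.inl = CocycleSections.ofFrameSystem F h1 t := CocycleSections.ext rfl
  have hcov_inl : ⨆ i, ⨆ x, Z.left.basicOpen ((S.restrict Sum.inl).coeff i x) = ⊤ := by rw [hinl]; exact hcovt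
  refine ⟨t, cc, hcov_inl, hlin', ?_⟩
  have e : ofCocycleSections F.U (S.restrict Sum.inl) hcov_inl =
      ofCocycleSections F.U (CocycleSections.ofFrameSystem F h1 t) hcovt := by
    congr 1
  rw [e]
  exact Ht

/-- **HEAD 3 — spanning families of a very ample `𝒪_Z(D)` are base-point free.** For `Ψ : Z ↪ ℙ^N_k` a closed immersion
over `k`, `D ∼ H_Ψ`, and `s_0, …, s_m` global sections of `𝒪_Z(D)` spanning `Γ(Z, 𝒪_Z(D))` over `Γ(Spec k, 𝒪)`, the loci
`Z_{s_j}` cover `Z` (in any rank-one frame system `F`): `Z_{t_a} ⊆ ⋃_j Z_{s_j}` as `t_a = ∑_j c_{aj} s_j`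
(★ `GeneratingSections.iSup_basicOpen_inr_eq_top_of_linear`). No properness needed. [cite: Hartshorne1977, II Thm. 7.1]
[cite: Hartshorne1977, II Prop. 7.2] -/
theorem iSup_basicOpen_coeff_eq_top_of_span_of_linEquiv_hyperplaneDivisor [IsClosedImmersion Ψ.left]
    (hlin : D.LinEquiv ((GeneratingSections.ofHom Ψ.left).divisor a₀ ha₀))
    (F : FrameSystem (Modules.lineBundle D.toUnitCocycle)) (h1 : ∀ x, F.rank x = 1) {m : ℕ}
    (s : Fin (m + 1) → Γ(Modules.lineBundle D.toUnitCocycle, ⊤))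
    (hs : ∀ σ : Γ(Modules.lineBundle D.toUnitCocycle, ⊤),
      SecMod.mk (L := Modules.lineBundle D.toUnitCocycle) (ρ := Z.hom.appTop.hom) (U := ⊤) σ ∈
        Submodule.span Γ(Spec (.of k), ⊤) (Set.range fun j ↦
          SecMod.mk (L := Modules.lineBundle D.toUnitCocycle) (ρ := Z.hom.appTop.hom) (U := ⊤) (s j))) :
    ⨆ i, ⨆ x, Z.left.basicOpen ((CocycleSections.ofFrameSystem F h1 s).coeff i x) = ⊤ := by
  obtain ⟨t, c, hcovt, hlin', -⟩ := D.exists_joint_linear Z Ψ a₀ ha₀ hlin F h1 s hs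
  have hinr : (CocycleSections.ofFrameSystem F h1 (Sum.elim t s)).restrict Sum.inr =
      CocycleSections.ofFrameSystem F h1 s := CocycleSections.ext rfl
  rw [← hinr]
  exact iSup_basicOpen_inr_eq_top_of_linear Z.hom _ c hlin' hcovt

/-- **HEAD 2 — `D` very ample ⟹ every spanning family of `Γ(𝒪_Z(D))` embeds.** For `Z` proper over the field `k`,
`Ψ : Z ↪ ℙ^N_k` a closed immersion over `k`, `D ∼ H_Ψ`, and global sections `s_0, …, s_m` of `𝒪_Z(D)` spanning
`Γ(Z, 𝒪_Z(D))` over `Γ(Spec k, 𝒪)` and generating `𝒪_Z(D)` (`hcov`, automatic by HEAD 3 — kept as a binder so that the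
conclusion is stated for the caller's own proof), the morphism `Z → ℙ^m_k` of `(𝒪_Z(D), s)` is a closed immersion; in
particular the complete linear system `|D|` embeds `Z`. Proof: the embedding family `t = Ψ^*x` is a `k`-combination of
`s` (`exists_joint_linear`), so ★ `GeneratingSections.isClosedImmersion_toProj_of_linear` (Hartshorne II Prop. 7.2 /
EGA II 4.4.4: affine charts `Z_{s_j}` near the fibre by universal closedness, surjectivity of the coordinate rings from that of
the `t`-charts) applies to the joint datum `(t, s)`. [cite: Hartshorne1977, II Thm. 7.1] [cite: Hartshorne1977, II Prop. 7.2] -/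
theorem isClosedImmersion_toProj_of_span_of_linEquiv_hyperplaneDivisor [IsClosedImmersion Ψ.left] [IsProper Z.hom]
    (hlin : D.LinEquiv ((GeneratingSections.ofHom Ψ.left).divisor a₀ ha₀))
    (F : FrameSystem (Modules.lineBundle D.toUnitCocycle)) (h1 : ∀ x, F.rank x = 1) {m : ℕ}
    (s : Fin (m + 1) → Γ(Modules.lineBundle D.toUnitCocycle, ⊤))
    (hs : ∀ σ : Γ(Modules.lineBundle D.toUnitCocycle, ⊤),
      SecMod.mk (L := Modules.lineBundle D.toUnitCocycle) (ρ := Z.hom.appTop.hom) (U := ⊤) σ ∈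
        Submodule.span Γ(Spec (.of k), ⊤) (Set.range fun j ↦
          SecMod.mk (L := Modules.lineBundle D.toUnitCocycle) (ρ := Z.hom.appTop.hom) (U := ⊤) (s j)))
    (hcov : ⨆ i, ⨆ x, Z.left.basicOpen ((CocycleSections.ofFrameSystem F h1 s).coeff i x) = ⊤) :
    IsClosedImmersion
      ((GeneratingSections.ofCocycleSections F.U (CocycleSections.ofFrameSystem F h1 s) hcov).toProj Z.hom) := by
  obtain ⟨t, c, hcovt, hlin', Ht⟩ := D.exists_joint_linear Z Ψ a₀ ha₀ hlin F h1 s hs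
  have hcov_inr := iSup_basicOpen_inr_eq_top_of_linear Z.hom _ c hlin' hcovt
  have Hs := isClosedImmersion_toProj_of_linear Z.hom _ c hlin' hcovt hcov_inr Ht
  have e : ofCocycleSections F.U (CocycleSections.ofFrameSystem F h1 s) hcov =
      ofCocycleSections F.U ((CocycleSections.ofFrameSystem F h1 (Sum.elim t s)).restrict Sum.inr) hcov_inr := by
    congr 1
  rw [e]
  exact Hs

/-- **HEAD 4 — `∃ hcov` form of HEAD 2** (generation derived from HEAD 3): for `Z` proper over `k`, `Ψ : Z ↪ ℙ^N_k` a closed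
immersion over `k`, `D ∼ H_Ψ` and `s` spanning `Γ(Z, 𝒪_Z(D))` over `Γ(Spec k, 𝒪)`, the `s_j` generate `𝒪_Z(D)` and their
morphism `Z → ℙ^m_k` is a closed immersion. [cite: Hartshorne1977, II Thm. 7.1] [cite: Hartshorne1977, II Prop. 7.2] -/
theorem exists_isClosedImmersion_toProj_of_span_of_linEquiv_hyperplaneDivisor [IsClosedImmersion Ψ.left]
    [IsProper Z.hom] (hlin : D.LinEquiv ((GeneratingSections.ofHom Ψ.left).divisor a₀ ha₀))
    (F : FrameSystem (Modules.lineBundle D.toUnitCocycle)) (h1 : ∀ x, F.rank x = 1) {m : ℕ}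
    (s : Fin (m + 1) → Γ(Modules.lineBundle D.toUnitCocycle, ⊤))
    (hs : ∀ σ : Γ(Modules.lineBundle D.toUnitCocycle, ⊤),
      SecMod.mk (L := Modules.lineBundle D.toUnitCocycle) (ρ := Z.hom.appTop.hom) (U := ⊤) σ ∈
        Submodule.span Γ(Spec (.of k), ⊤) (Set.range fun j ↦
          SecMod.mk (L := Modules.lineBundle D.toUnitCocycle) (ρ := Z.hom.appTop.hom) (U := ⊤) (s j))) :
    ∃ hcov : ⨆ i, ⨆ x, Z.left.basicOpen ((CocycleSections.ofFrameSystem F h1 s).coeff i x) = ⊤,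
      IsClosedImmersion
        ((GeneratingSections.ofCocycleSections F.U (CocycleSections.ofFrameSystem F h1 s) hcov).toProj Z.hom) :=
  ⟨_, D.isClosedImmersion_toProj_of_span_of_linEquiv_hyperplaneDivisor Z Ψ a₀ ha₀ hlin F h1 s hs
    (D.iSup_basicOpen_coeff_eq_top_of_span_of_linEquiv_hyperplaneDivisor Z Ψ a₀ ha₀ hlin F h1 s hs)⟩

end VeryAmple

end CartierDivisor

end Literature.AlgebraicGeometry.Motives

end
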